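import Summits.FinalStateConjecture.FinalStateConjecture.Theorems.ClusterCompletenessAdiabaticMultiKerrILEDWeightedTCurrent
import Summits.FinalStateConjecture.FinalStateConjecture.Theorems.ClusterCompletenessAdiabaticMultiKerrILEDWeightedTEnergyGraph

/-!
# Route ClusterCompleteness — crux `AdiabaticMultiKerrILED`, line `Sketch`:
# the rest-frame far-energy bound of the tails-cut zero-spin zone, from the weighted inequality

Helper file for the crux `stmt-FinalStateConjecture-14310`
(`Summit.FinalStateConjecture.FinalStateConjecture.Theses.ClusterCompleteness.AdiabaticMultiKerrILED`),
line `Sketch`, stub `restFrame_farEnergyBound_of_weighted` (lead c7, wave 2).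

Setting (one zone, zero spin, rest frame): the coefficient field is the tails-cut Kerr–Schild field
`G₀ = KerrSchild.inverseMetric φ (Kerr.nullVector 0)`, `φ = χ(2 − r/(8M)) · 2H`
(`χ = Real.smoothTransition`), the current is the Killing energy current
`(J^T)^μ = KerrSchild.multiplierCurrent G₀ KerrSchild.timeField Φ`, the weight is
`W = χ(u₂/ε − 1) · χ(u₁)` (`u₂ = Kerr.horizonFn M 0`, `u₁ = Kerr.coneFn A c`), and the lab slices
are the tilted leaves `{x⁰ = s + F(x⃗)}` of a `C²` height of slope `≤ 1/2`, conormal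
`n = Kerr.graphConormal F = (1, −∇F)`.

* `restFrame_farEnergyBound_of_weighted` — **the registered stub** (the assembly with limits):
  if the weighted `T`-energy inequality `∫_{leaf s} W (−∑ (J^T)^μ n_μ) ≤ ∫_{leaf 0} W (−∑ (J^T)^μ n_μ)`
  holds for all `ε > 0`, `A`, `c`, `0 ≤ s` with `s + F(c) < A`, then for every `η > 0` there is
  `C = C(η)` with `∫_{leaf s ∩ {r ≥ (2+η)M}} ∑ (∂Φ)² ≤ C ∫_{leaf 0 ∩ {r > 2M}} ∑ (∂Φ)²` in `[0, ∞]`.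
  The constant is `C = C_up / c_low` with `c_low` from the leaf coercivity
  `tEnergy_leafFlux_coercive (2/(2+η))` (`0 ≤ φ ≤ 2M/r ≤ 2/(2+η)` on `{r ≥ (2+η)M}`) and `C_up`
  from `abs_sum_multiplierCurrent_timeField_mul_le 1`. Step 1 (`restFrame_lintegral_chain` with
  the pointwise facts): on the core set `{‖y‖ ≤ R, u₂ ≥ 2ε, r ≥ (2+η)M}` of the leaf `s` the weight
  with vertex `(A, 0)`, `A = s + F(0) + 2R + 2`, equals `1` (`restFrame_weight_eq_one`), the leaf
  integrands are continuous (`contDiff_weightedTCurrent`), compactly supported and non-negative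
  (dominant energy condition, `W ≠ 0 ⇒ r > 2M`), so Bochner and Lebesgue integrals agree and the
  inequality passes to `[0, ∞]`; Step 2: exhaustion `R = n → ∞`, `ε = 1/(n+1) → 0`
  (`MeasureTheory.setLIntegral_iUnion_of_directed`).

Dafermos–Rodnianski–Shlapentokh-Rothman arXiv:1402.7034, §2.3.2 and §3.1 (`J^T_μ n^μ ∼ ∑ (∂ψ)²`
away from the horizon); Hawking–Ellis 1973, §4.3 Lemma 4.3.1. [folklore]
-/

noncomputable section

-- the doubled `FinalStateConjecture.FinalStateConjecture` path component trips dupNamespace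
set_option linter.dupNamespace false

open Set Filter Metric MeasureTheory
open scoped BigOperators Topology ENNReal
open Literature.Geometry.Lorentzian

namespace Summit.FinalStateConjecture.FinalStateConjecture.Theorems

/-! ### Pointwise facts at a leaf point -/

/-- The conormal `n = (1, −∇F)` of a leaf of slope `‖∇F‖ ≤ ½` has `∑ᵢ nᵢ² = ∑ᵢ (∂ᵢF)² ≤ ‖∇F‖² ≤ ¼`
(`Kerr.sum_sq_partialE3_le`). [folklore] -/
theorem restFrame_graphConormal_sq_le {F : E3 → ℝ} (hdF : ∀ y, ‖fderiv ℝ F y‖ ≤ 2⁻¹) (y : E3) :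
    ∑ i : Fin 3, Kerr.graphConormal F y i.succ ^ 2 ≤ 4⁻¹ := by
  have h1 : ∑ i : Fin 3, Kerr.graphConormal F y i.succ ^ 2 = ∑ i, Kerr.partialE3 F y i ^ 2 :=
    Finset.sum_congr rfl fun i _ ↦ by rw [Kerr.graphConormal_succ, neg_sq]
  rw [h1]
  refine (Kerr.sum_sq_partialE3_le F y).trans ?_
  calc ‖fderiv ℝ F y‖ ^ 2 ≤ (2⁻¹) ^ 2 := pow_le_pow_left₀ (norm_nonneg _) (hdF y) 2
    _ = 4⁻¹ := by norm_num

/-- For `a = 0` and `r > 0` the Kerr–Schild null vector `ℓ♯` is Minkowski-null with `η(ℓ♯, ∂₀) = 1`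
(`Kerr.nullCovector_nullVector`, `Kerr.nullCovector_basisVector_zero`). [folklore] -/
theorem restFrame_nullVector_facts {x : E4} (hx : 0 < Kerr.radius 0 x) :
    Minkowski.bilin (Kerr.nullVector 0 x) (Kerr.nullVector 0 x) = 0 ∧
      Minkowski.bilin (Kerr.nullVector 0 x) (E4.basisVector 0) = 1 := by
  constructor
  · rw [Kerr.bilin_nullVector, Kerr.nullCovector_nullVector hx]
  · rw [Kerr.bilin_nullVector, Kerr.nullCovector_basisVector_zero]

/-- **The tails-cut profile is uniformly below `1` away from the horizon**: on `{r ≥ (2+η)M}`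
(`M, η > 0`), `χ(2 − r/(8M)) · 2H ≤ 2M/r ≤ 2/(2+η)` (`χ ≤ 1`, `H ≤ M/r`, `Kerr.scalarH_le_div`).
[folklore] -/
theorem restFrame_profile_le {M η : ℝ} (hM : 0 < M) (hη : 0 < η) {x : E4}
    (hx : (2 + η) * M ≤ Kerr.radius 0 x) :
    Real.smoothTransition (2 - Kerr.radius 0 x / (8 * M)) * (2 * Kerr.scalarH M 0 x) ≤
      2 / (2 + η) := by
  have hxpos : 0 < Kerr.radius 0 x := lt_of_lt_of_le (by positivity) hx
  have hH : Kerr.scalarH M 0 x ≤ M / Kerr.radius 0 x := Kerr.scalarH_le_div hM.le 0 hxpos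
  have hH0 : 0 ≤ Kerr.scalarH M 0 x := Kerr.scalarH_nonneg hM.le 0 x
  have hMr : M / Kerr.radius 0 x ≤ 1 / (2 + η) := by
    rw [div_le_div_iff₀ hxpos (by positivity)]
    linarith
  have h2 : 2 * Kerr.scalarH M 0 x ≤ 2 * (1 / (2 + η)) := by linarith [hH.trans hMr]
  calc Real.smoothTransition (2 - Kerr.radius 0 x / (8 * M)) * (2 * Kerr.scalarH M 0 x)
      ≤ 1 * (2 * Kerr.scalarH M 0 x) :=
        mul_le_mul_of_nonneg_right (Real.smoothTransition.le_one _) (by positivity)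
    _ ≤ 2 * (1 / (2 + η)) := by rw [one_mul]; exact h2
    _ = 2 / (2 + η) := by ring

/-! ### The weight `W = χ(u₂/ε − 1) χ(u₁)` -/

/-- **Where the weight is nonzero** (`M > 0`, `ε > 0`): `r > 2M` (`u₂ > ε > 0`, `r₊ = 2M`,
`Kerr.rPlus_lt_radius_of_horizonFn_pos`) and `u₁ ≥ 0` (`χ` vanishes on `(−∞, 0]`). [folklore] -/
theorem restFrame_of_weight_ne_zero {M ε A : ℝ} {c : E3} (hM : 0 < M) (hε : 0 < ε) {x : E4}
    (hW : Real.smoothTransition (Kerr.horizonFn M 0 x / ε - 1) *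
      Real.smoothTransition (Kerr.coneFn A c x) ≠ 0) :
    2 * M < Kerr.radius 0 x ∧ 0 ≤ Kerr.coneFn A c x := by
  refine ⟨?_, ?_⟩
  · rw [← Kerr.rPlus_zero_right hM.le]
    exact Kerr.rPlus_lt_radius_of_horizonFn_pos
      (hε.trans (Kerr.lt_horizonFn_of_weight_ne_zero hε (left_ne_zero_of_mul hW)))
  · by_contra hlt
    exact right_ne_zero_of_mul hW (Real.smoothTransition.zero_of_nonpos (not_le.mp hlt).le)

/-- **The weight with vertex `(A, 0)`, `A ≥ t + F(0) + 2R + 2`, is saturated on the core of the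
leaf `{x⁰ = t + F}`**: at `(t + F(y), y)` with `‖y‖ ≤ R` and `u₂ ≥ 2ε` one has `W = 1`
(`F(y) ≤ F(0) + ‖y‖`, so `A − t − F(y) ≥ ‖y‖ + 1` and `u₁ ≥ 1`; `Kerr.weight_eq_one_of_le_horizonFn`).
[folklore] -/
theorem restFrame_weight_eq_one {M ε A t R : ℝ} {F : E3 → ℝ} (hε : 0 < ε)
    (hFub : ∀ y : E3, F y ≤ F 0 + ‖y‖) (hA : t + F 0 + 2 * R + 2 ≤ A) {y : E3} (hy : ‖y‖ ≤ R)
    (hh : 2 * ε ≤ Kerr.horizonFn M 0 (E4.ofTimeSpace (t + F y) y)) :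
    Real.smoothTransition (Kerr.horizonFn M 0 (E4.ofTimeSpace (t + F y) y) / ε - 1) *
      Real.smoothTransition (Kerr.coneFn A 0 (E4.ofTimeSpace (t + F y) y)) = 1 := by
  rw [Kerr.weight_eq_one_of_le_horizonFn hε hh, one_mul]
  refine Real.smoothTransition.one_of_one_le ?_
  have hn : 0 ≤ ‖y‖ := norm_nonneg y
  have hFy : F y ≤ F 0 + R := (hFub y).trans (by linarith)
  have hAy : ‖y‖ + 1 ≤ A - (t + F y) := by linarith
  simp only [Kerr.coneFn, E4.ofTimeSpace_apply_zero, E4.spatial_ofTimeSpace, sub_zero]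
  nlinarith

/-- **The weighted leaf integrands are supported in a fixed ball**: if `W ≠ 0` at a point
`(t + F(y), y)` of a leaf between the graph-times `0 ≤ t ≤ s`, where `|F(y) − F(0)| ≤ ‖y‖/2` and
`s + F(0) < A` (vertex `(A, 0)`), then `‖y‖ ≤ ‖0‖ + 2(A − F(0))` (`u₁ ≥ 0` there, and the slab
geometry `spatialNorm_le_of_coneFn_nonneg_of_slab`). [folklore] -/
theorem restFrame_norm_le_of_weight_ne_zero {M ε A s t : ℝ} {F : E3 → ℝ} (hM : 0 < M)
    (hε : 0 < ε) (hlip : ∀ y : E3, |F y - F 0| ≤ 2⁻¹ * ‖y - 0‖) (hsA : s + F 0 < A)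
    (ht0 : 0 ≤ t) (hts : t ≤ s) {y : E3}
    (hW : Real.smoothTransition (Kerr.horizonFn M 0 (E4.ofTimeSpace (t + F y) y) / ε - 1) *
      Real.smoothTransition (Kerr.coneFn A 0 (E4.ofTimeSpace (t + F y) y)) ≠ 0) :
    ‖y‖ ≤ ‖(0 : E3)‖ + 2 * (A - F 0) := by
  have hcone := (restFrame_of_weight_ne_zero hM hε hW).2
  have h := (spatialNorm_le_of_coneFn_nonneg_of_slab (x := E4.ofTimeSpace (t + F y) y)
    (by simpa only [E4.spatial_ofTimeSpace] using hlip y) hsA hcone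
    (by simp only [E4.spatial_ofTimeSpace, E4.ofTimeSpace_apply_zero]; linarith)
    (by simp only [E4.spatial_ofTimeSpace, E4.ofTimeSpace_apply_zero]; linarith)).1
  rwa [E4.spatialNorm_ofTimeSpace] at h

/-- **The weighted leaf integrand is continuous**: `y ↦ W(x) (−∑_μ (J^T)^μ(x) n_μ(y))`,
`x = (t + F(y), y)`, for `F, Φ ∈ C²` (`M > 0`, `ε > 0`) — it is `−∑_μ (W (J^T)^μ)(x) n_μ(y)` with
`W (J^T)^μ ∈ C¹(ℝ⁴)` (`contDiff_weightedTCurrent`) and `n = (1, −∇F)` continuous. [folklore] -/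
theorem restFrame_continuous_leafIntegrand {M ε A : ℝ} (c : E3) {F : E3 → ℝ} {Φ : E4 → ℝ}
    (hM : 0 < M) (hε : 0 < ε) (hF : ContDiff ℝ 2 F) (hΦ : ContDiff ℝ 2 Φ) (t : ℝ) :
    Continuous fun y : E3 ↦
      (Real.smoothTransition (Kerr.horizonFn M 0 (E4.ofTimeSpace (t + F y) y) / ε - 1) *
          Real.smoothTransition (Kerr.coneFn A c (E4.ofTimeSpace (t + F y) y))) *
        (-∑ μ, KerrSchild.multiplierCurrent
            (KerrSchild.inverseMetric
              (fun z ↦ Real.smoothTransition (2 - Kerr.radius 0 z / (8 * M)) * (2 * Kerr.scalarH M 0 z))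
              (Kerr.nullVector 0))
            KerrSchild.timeField Φ (E4.ofTimeSpace (t + F y) y) μ * Kerr.graphConormal F y μ) := by
  have hgraph : Continuous fun y : E3 ↦ E4.ofTimeSpace (t + F y) y :=
    E4.continuous_ofTimeSpace' (continuous_const.add hF.continuous) continuous_id
  have hF1 : ContDiff ℝ 1 F := hF.of_le one_le_two
  have hnc : ∀ μ, Continuous fun y : E3 ↦ Kerr.graphConormal F y μ := by
    intro μ
    refine Fin.cases ?_ (fun i ↦ ?_) μ
    · simp only [Kerr.graphConormal_zero]
      exact continuous_const
    · simp only [Kerr.graphConormal_succ, Kerr.partialE3]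
      exact ((hF1.continuous_fderiv one_ne_zero).clm_apply continuous_const).neg
  have hWJ := fun μ ↦ (contDiff_weightedTCurrent M ε A c Φ hM hε hΦ μ).continuous.comp hgraph
  have h2 : Continuous fun y : E3 ↦ -∑ μ,
      (Real.smoothTransition (Kerr.horizonFn M 0 (E4.ofTimeSpace (t + F y) y) / ε - 1) *
          Real.smoothTransition (Kerr.coneFn A c (E4.ofTimeSpace (t + F y) y))) *
        KerrSchild.multiplierCurrent
          (KerrSchild.inverseMetric
            (fun z ↦ Real.smoothTransition (2 - Kerr.radius 0 z / (8 * M)) * (2 * Kerr.scalarH M 0 z))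
            (Kerr.nullVector 0))
          KerrSchild.timeField Φ (E4.ofTimeSpace (t + F y) y) μ * Kerr.graphConormal F y μ :=
    (continuous_finsetSum _ fun μ _ ↦ (hWJ μ).mul (hnc μ)).neg
  refine h2.congr fun y ↦ ?_
  rw [mul_neg, Finset.mul_sum]
  exact congrArg Neg.neg (Finset.sum_congr rfl fun μ _ ↦ by ring)

/-! ### The measure-theoretic bookkeeping -/

/-- **From the real weighted inequality to the bound in `[0, ∞]`.** If `∫ I_s ≤ ∫ I_0` for
non-negative integrable leaf integrands, `f_s ≤ c⁻¹ I_s` on a measurable set `S` (`c > 0`) and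
`I_0 ≤ C f_0 𝟙_{T₀}` (`T₀` measurable), then `∫_S f_s ≤ (C/c) ∫_{T₀} f_0` in `[0, ∞]`
(`MeasureTheory.ofReal_integral_eq_lintegral_ofReal` twice). [folklore] -/
theorem restFrame_lintegral_chain {Is I0 : E3 → ℝ} (hIs : Integrable Is) (hIs0 : ∀ y, 0 ≤ Is y)
    (hI0 : Integrable I0) (hI00 : ∀ y, 0 ≤ I0 y) (hineq : ∫ y, Is y ≤ ∫ y, I0 y)
    {S T0 : Set E3} (hS : MeasurableSet S) (hT0 : MeasurableSet T0) {c C : ℝ} (hc : 0 < c)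
    {fs f0 : E3 → ℝ≥0∞}
    (hlow : ∀ y ∈ S, fs y ≤ ENNReal.ofReal (c⁻¹ * Is y))
    (hup : ∀ y, ENNReal.ofReal (I0 y) ≤ T0.indicator (fun y ↦ ENNReal.ofReal C * f0 y) y) :
    ∫⁻ y in S, fs y ≤ ENNReal.ofReal (C / c) * ∫⁻ y in T0, f0 y := by
  have hc' : 0 ≤ c⁻¹ := inv_nonneg.mpr hc.le
  calc ∫⁻ y in S, fs y ≤ ∫⁻ y in S, ENNReal.ofReal (c⁻¹ * Is y) := setLIntegral_mono' hS hlow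
    _ ≤ ∫⁻ y, ENNReal.ofReal (c⁻¹ * Is y) := setLIntegral_le_lintegral _ _
    _ = ENNReal.ofReal (∫ y, c⁻¹ * Is y) :=
        (ofReal_integral_eq_lintegral_ofReal (hIs.const_mul c⁻¹)
          (ae_of_all _ fun y ↦ mul_nonneg hc' (hIs0 y))).symm
    _ ≤ ENNReal.ofReal (c⁻¹ * ∫ y, I0 y) := by
        rw [integral_const_mul]
        exact ENNReal.ofReal_le_ofReal (mul_le_mul_of_nonneg_left hineq hc')
    _ = ENNReal.ofReal c⁻¹ * ∫⁻ y, ENNReal.ofReal (I0 y) := by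
        rw [ENNReal.ofReal_mul hc', ofReal_integral_eq_lintegral_ofReal hI0 (ae_of_all _ hI00)]
    _ ≤ ENNReal.ofReal c⁻¹ * ∫⁻ y, T0.indicator (fun y ↦ ENNReal.ofReal C * f0 y) y :=
        mul_le_mul_right (lintegral_mono fun y ↦ hup y) _
    _ = ENNReal.ofReal (C / c) * ∫⁻ y in T0, f0 y := by
        rw [lintegral_indicator hT0, lintegral_const_mul' _ _ ENNReal.ofReal_ne_top, ← mul_assoc,
          ← ENNReal.ofReal_mul hc', div_eq_inv_mul]

/-- **Exhaustion**: a bound for `∫_{S n} f` uniform along an increasing sequence of sets passes to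
their union (`MeasureTheory.setLIntegral_iUnion_of_directed`). [folklore] -/
theorem restFrame_lintegral_exhaustion {f : E3 → ℝ≥0∞} {S : ℕ → Set E3} (hmono : Monotone S)
    {B : ℝ≥0∞} (hB : ∀ n, ∫⁻ y in S n, f y ≤ B) : ∫⁻ y in ⋃ n, S n, f y ≤ B := by
  rw [setLIntegral_iUnion_of_directed f
    (fun i j ↦ ⟨max i j, hmono (le_max_left i j), hmono (le_max_right i j)⟩)]
  exact iSup_le hB

/-! ### The registered stub -/

/-- **The rest-frame far-energy bound of the tails-cut zero-spin zone on tilted leaves, from the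
weighted `T`-energy inequality** (crux `stmt-FinalStateConjecture-14310`, line `Sketch`, stub
`restFrame_farEnergyBound_of_weighted`). For `M, η > 0` there is `C = C(η)` such that for every `C²`
height `F` of slope `≤ ½`, every `Φ ∈ C²(ℝ⁴)` satisfying the weighted energy inequality
`∫_{leaf s} W (−∑_μ (J^T)^μ n_μ) dy ≤ ∫_{leaf 0} W (−∑_μ (J^T)^μ n_μ) dy` for all weights
`W = χ(u₂/ε − 1) χ(u₁)` (`ε > 0`, vertex `(A, c)` with `s + F(c) < A`) and every `s ≥ 0`:
`∫_{leaf s ∩ {r ≥ (2+η)M}} ∑_μ (∂_μΦ)² dy ≤ C ∫_{leaf 0 ∩ {r > 2M}} ∑_μ (∂_μΦ)² dy` in `[0, ∞]`.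
Here `C = C_up/c_low`, `c_low ∑(∂Φ)² ≤ −∑ (J^T)^μ n_μ` where `0 ≤ φ ≤ 2/(2+η)`
(`tEnergy_leafFlux_coercive`, `restFrame_profile_le`) and `|∑ (J^T)^μ n_μ| ≤ C_up ∑(∂Φ)²` where
`0 ≤ φ ≤ 1` (`abs_sum_multiplierCurrent_timeField_mul_le`); on the core set
`{‖y‖ ≤ R, u₂ ≥ 2ε, r ≥ (2+η)M}` of the leaf `s` the weight with vertex `(s + F(0) + 2R + 2, 0)` is
`1`, both leaf integrands are continuous, compactly supported and `≥ 0` (dominant energy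
condition where `W ≠ 0 ⇒ r > 2M`), so the real inequality becomes the `[0, ∞]` bound
(`restFrame_lintegral_chain`), uniformly in `R`, `ε`; finally `R = n → ∞`, `ε = 1/(n+1) → 0`
exhaust `{r ≥ (2+η)M}` (`restFrame_lintegral_exhaustion`). Dafermos–Rodnianski–Shlapentokh-Rothman
arXiv:1402.7034, §2.3.2, §3.1; Hawking–Ellis 1973, §4.3 Lemma 4.3.1. [folklore] -/
theorem restFrame_farEnergyBound_of_weighted : ∀ (M η : ℝ), 0 < M → 0 < η → ∃ C : NNReal, ∀ (F : E3 → ℝ) (Φ : E4 → ℝ), ContDiff ℝ 2 F → (∀ y, ‖fderiv ℝ F y‖ ≤ 2⁻¹) → ContDiff ℝ 2 Φ → (∀ (ε A : ℝ) (c : E3) (s : ℝ), 0 < ε → 0 ≤ s → s + F c < A → ∫ y : E3, (Real.smoothTransition (Kerr.horizonFn M 0 (E4.ofTimeSpace (s + F y) y) / ε - 1) * Real.smoothTransition (Kerr.coneFn A c (E4.ofTimeSpace (s + F y) y))) * (-∑ μ, KerrSchild.multiplierCurrent (KerrSchild.inverseMetric (fun z ↦ Real.smoothTransition (2 - Kerr.radius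 0 z / (8 * M)) * (2 * Kerr.scalarH M 0 z)) (Kerr.nullVector 0)) KerrSchild.timeField Φ (E4.ofTimeSpace (s + F y) y) μ * Kerr.graphConormal F y μ) ≤ ∫ y : E3, (Real.smoothTransition (Kerr.horizonFn M 0 (E4.ofTimeSpace (0 + F y) y) / ε - 1) * Real.smoothTransition (Kerr.coneFn A c (E4.ofTimeSpace (0 + F y) y))) * (-∑ μ, KerrSchild.multiplierCurrent (KerrSchild.inverseMetric (fun z ↦ Real.smoothTransition (2 - Kerr.radius 0 z / (8 * M)) * (2 * Kerr.scalarH M 0 z)) (Kerr.nullVector 0)) KerrSchild.timeField Φ (E4.ofTimeSpace (0 + F y) y) μ * Kerr.graphConormal F y μ)) → ∀ s : ℝ, 0 ≤ s → ∫⁻ y in {y : E3 | (2 + η) * M ≤ Kerr.radius 0 (E4.ofTimeSpace (s + F y) y)}, ENNReal.ofReal (∑ μ : Fin 4, (fderiv ℝ Φ (E4.ofTimeSpace (s + F y) y) (E4.basisVector μ)) ^ 2) ≤ (C : ENNReal) * ∫⁻ y in {y : E3 | 2 * M < Kerr.radius 0 (E4.ofTimeSpace (0 + F y) y)}, ENNReal.ofReal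 (∑ μ : Fin 4, (fderiv ℝ Φ (E4.ofTimeSpace (0 + F y) y) (E4.basisVector μ)) ^ 2) := by
  intro M η hM hη
  -- ### the constants: coercivity on `{r ≥ (2+η)M}` and boundedness on `{r > 2M}`
  have hφ₀ : 2 / (2 + η) < 1 := by rw [div_lt_one (by positivity)]; linarith
  obtain ⟨c, hc, hcoer⟩ := tEnergy_leafFlux_coercive (2 / (2 + η)) hφ₀
  obtain ⟨C, hC0, hup⟩ := abs_sum_multiplierCurrent_timeField_mul_le 1 zero_le_one
  refine ⟨(C / c).toNNReal, ?_⟩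
  intro F Φ hF hdF hΦ hineq s hs
  rw [ENNReal.ofNNReal_toNNReal]
  -- ### notation
  set φ : E4 → ℝ := fun z ↦ Real.smoothTransition (2 - Kerr.radius 0 z / (8 * M)) *
    (2 * Kerr.scalarH M 0 z) with hφ
  set J : E4 → Fin 4 → ℝ :=
    KerrSchild.multiplierCurrent (KerrSchild.inverseMetric φ (Kerr.nullVector 0))
      KerrSchild.timeField Φ with hJ
  set fd : ℝ → E3 → ℝ≥0∞ := fun t y ↦
    ENNReal.ofReal (∑ μ, fderiv ℝ Φ (E4.ofTimeSpace (t + F y) y) (E4.basisVector μ) ^ 2) with hfd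
  set T0 : Set E3 := {y : E3 | 2 * M < Kerr.radius 0 (E4.ofTimeSpace (0 + F y) y)} with hT0
  show ∫⁻ y in {y : E3 | (2 + η) * M ≤ Kerr.radius 0 (E4.ofTimeSpace (s + F y) y)}, fd s y ≤
    ENNReal.ofReal (C / c) * ∫⁻ y in T0, fd 0 y
  -- ### the slope of `F`, the graph maps, measurability
  have hlip : ∀ y : E3, |F y - F 0| ≤ 2⁻¹ * ‖y - 0‖ := fun y ↦ by
    rw [← Real.norm_eq_abs]
    exact convex_univ.norm_image_sub_le_of_norm_fderiv_le
      (fun z _ ↦ hF.differentiable (by simp) z) (fun z _ ↦ hdF z) (mem_univ 0) (mem_univ y)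
  have hFub : ∀ y : E3, F y ≤ F 0 + ‖y‖ := fun y ↦ by
    have h := (abs_le.mp (hlip y)).2
    rw [sub_zero] at h
    linarith [norm_nonneg y]
  have hgraph : ∀ t : ℝ, Continuous fun y : E3 ↦ E4.ofTimeSpace (t + F y) y := fun t ↦
    E4.continuous_ofTimeSpace' (continuous_const.add hF.continuous) continuous_id
  have hT0m : MeasurableSet T0 :=
    (isOpen_lt continuous_const ((Kerr.continuous_radius 0).comp (hgraph 0))).measurableSet
  have h2η : 2 * M < (2 + η) * M := by nlinarith [mul_pos hη hM]
  -- ### pointwise flux facts at points with `r > 2M`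
  have hflux : ∀ (x : E4) (y : E3), 2 * M < Kerr.radius 0 x →
      0 ≤ -∑ μ, J x μ * Kerr.graphConormal F y μ ∧
        -∑ μ, J x μ * Kerr.graphConormal F y μ ≤ C * ∑ μ, fderiv ℝ Φ x (E4.basisVector μ) ^ 2 ∧
        ((2 + η) * M ≤ Kerr.radius 0 x →
          c * ∑ μ, fderiv ℝ Φ x (E4.basisVector μ) ^ 2 ≤ -∑ μ, J x μ * Kerr.graphConormal F y μ) := by
    intro x y hx
    have hxpos : 0 < Kerr.radius 0 x := lt_trans (by positivity) hx
    obtain ⟨hnull, hnorm⟩ := restFrame_nullVector_facts hxpos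
    have hφ0 : 0 ≤ φ x := weightedT_profile_nonneg hM.le 0 x
    have hφ1 : φ x < 1 := weightedT_profile_lt_one hM.le hx
    have hn0 : Kerr.graphConormal F y 0 = 1 := Kerr.graphConormal_zero F y
    have hn4 := restFrame_graphConormal_sq_le hdF y
    have hn1 : ∑ i : Fin 3, Kerr.graphConormal F y i.succ ^ 2 ≤ 1 := hn4.trans (by norm_num)
    refine ⟨neg_sum_multiplierCurrent_timeField_mul_nonneg φ (Kerr.nullVector 0) Φ x
        (Kerr.graphConormal F y) hφ0 hφ1 hnull hnorm ⟨hn0, hn1⟩, (le_abs_self _).trans ?_,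
      fun hxη ↦ hcoer φ (Kerr.nullVector 0) Φ x (Kerr.graphConormal F y) hφ0
        (restFrame_profile_le hM hη hxη) hnull hnorm hn0 hn4⟩
    rw [abs_neg]
    exact hup φ (Kerr.nullVector 0) Φ x (Kerr.graphConormal F y) hφ0 hφ1.le hnull hnorm hn0 hn1
  -- ### Step 1: the bound on the core set `{‖y‖ ≤ R, u₂ ≥ 2ε, r ≥ (2+η)M}` of the leaf `s`
  have hcore : ∀ (R ε : ℝ), 0 ≤ R → 0 < ε →
      ∫⁻ y in {y : E3 | ‖y‖ ≤ R ∧ 2 * ε ≤ Kerr.horizonFn M 0 (E4.ofTimeSpace (s + F y) y) ∧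
          (2 + η) * M ≤ Kerr.radius 0 (E4.ofTimeSpace (s + F y) y)}, fd s y ≤
        ENNReal.ofReal (C / c) * ∫⁻ y in T0, fd 0 y := by
    intro R ε hR hε
    set A : ℝ := s + F 0 + 2 * R + 2 with hA
    have hsA : s + F 0 < A := by rw [hA]; linarith
    -- the weight with vertex `(A, 0)` and the leaf integrands
    set W : E4 → ℝ := fun x ↦ Real.smoothTransition (Kerr.horizonFn M 0 x / ε - 1) *
      Real.smoothTransition (Kerr.coneFn A 0 x) with hW
    set I : ℝ → E3 → ℝ := fun t y ↦ W (E4.ofTimeSpace (t + F y) y) *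
      (-∑ μ, J (E4.ofTimeSpace (t + F y) y) μ * Kerr.graphConormal F y μ) with hI
    have hkey : ∫ y, I s y ≤ ∫ y, I 0 y := hineq ε A 0 s hε hs hsA
    have hW0 : ∀ x, 0 ≤ W x := fun x ↦
      mul_nonneg (Real.smoothTransition.nonneg _) (Real.smoothTransition.nonneg _)
    have hW1 : ∀ x, W x ≤ 1 := fun x ↦
      mul_le_one₀ (Real.smoothTransition.le_one _) (Real.smoothTransition.nonneg _)
        (Real.smoothTransition.le_one _)
    have hWr : ∀ x, W x ≠ 0 → 2 * M < Kerr.radius 0 x := fun x hx ↦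
      (restFrame_of_weight_ne_zero hM hε hx).1
    -- the leaf integrands: continuous, non-negative, supported in a fixed ball, integrable
    have hIc : ∀ t, Continuous (I t) := fun t ↦
      restFrame_continuous_leafIntegrand 0 hM hε hF hΦ t
    have hInn : ∀ t y, 0 ≤ I t y := by
      intro t y
      by_cases hWy : W (E4.ofTimeSpace (t + F y) y) = 0
      · show 0 ≤ W (E4.ofTimeSpace (t + F y) y) * _
        rw [hWy, zero_mul]
      · exact mul_nonneg (hW0 _) (hflux _ y (hWr _ hWy)).1
    have hIz : ∀ t, 0 ≤ t → t ≤ s → ∀ y, y ∉ closedBall (0 : E3) (‖(0 : E3)‖ + 2 * (A - F 0)) →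
        I t y = 0 := by
      intro t ht0 hts y hy
      by_contra hne
      have hWne : W (E4.ofTimeSpace (t + F y) y) ≠ 0 := left_ne_zero_of_mul hne
      exact hy (mem_closedBall_zero_iff.mpr
        (restFrame_norm_le_of_weight_ne_zero hM hε hlip hsA ht0 hts hWne))
    have hIi : ∀ t, 0 ≤ t → t ≤ s → Integrable (I t) := fun t ht0 hts ↦
      (hIc t).integrable_of_hasCompactSupport
        (HasCompactSupport.intro (isCompact_closedBall _ _) (hIz t ht0 hts))
    -- the core set
    set S : Set E3 := {y : E3 | ‖y‖ ≤ R ∧ 2 * ε ≤ Kerr.horizonFn M 0 (E4.ofTimeSpace (s + F y) y) ∧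
      (2 + η) * M ≤ Kerr.radius 0 (E4.ofTimeSpace (s + F y) y)} with hS
    have hSm : MeasurableSet S :=
      ((isClosed_le continuous_norm continuous_const).inter
        ((isClosed_le continuous_const ((Kerr.continuous_horizonFn M 0).comp (hgraph s))).inter
          (isClosed_le continuous_const ((Kerr.continuous_radius 0).comp (hgraph s))))).measurableSet
    refine restFrame_lintegral_chain (hIi s hs le_rfl) (hInn s) (hIi 0 le_rfl hs) (hInn 0) hkey hSm
      hT0m hc ?_ ?_
    · -- on the core set: `W = 1` and coercivity
      intro y hy
      obtain ⟨hyR, hyh, hyr⟩ := hy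
      have hW1y : W (E4.ofTimeSpace (s + F y) y) = 1 :=
        restFrame_weight_eq_one hε hFub hA.symm.le hyR hyh
      have h3 := (hflux _ y (h2η.trans_le hyr)).2.2 hyr
      refine ENNReal.ofReal_le_ofReal ?_
      show ∑ μ, fderiv ℝ Φ (E4.ofTimeSpace (s + F y) y) (E4.basisVector μ) ^ 2 ≤
        c⁻¹ * (W (E4.ofTimeSpace (s + F y) y) * _)
      rw [hW1y, one_mul, ← div_eq_inv_mul, le_div_iff₀ hc]
      linarith
    · -- at the initial leaf: `W ≤ 𝟙_{r > 2M}` and boundedness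
      intro y
      by_cases hWy : W (E4.ofTimeSpace (0 + F y) y) = 0
      · have hI0 : I 0 y = 0 := by
          show W (E4.ofTimeSpace (0 + F y) y) * _ = 0
          rw [hWy, zero_mul]
        rw [hI0, ENNReal.ofReal_zero]
        exact zero_le
      · have hr : 2 * M < Kerr.radius 0 (E4.ofTimeSpace (0 + F y) y) := hWr _ hWy
        rw [indicator_of_mem (show y ∈ T0 from hr), hfd, ← ENNReal.ofReal_mul hC0]
        refine ENNReal.ofReal_le_ofReal ?_
        calc I 0 y ≤ 1 * (-∑ μ, J (E4.ofTimeSpace (0 + F y) y) μ * Kerr.graphConormal F y μ) :=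
              mul_le_mul_of_nonneg_right (hW1 _) (hflux _ y hr).1
          _ ≤ C * ∑ μ, fderiv ℝ Φ (E4.ofTimeSpace (0 + F y) y) (E4.basisVector μ) ^ 2 := by
              rw [one_mul]
              exact (hflux _ y hr).2.1
  -- ### Step 2: exhaustion of `{r ≥ (2+η)M}` by the core sets, `R = n`, `ε = 1/(n+1)`
  have hmono : Monotone fun n : ℕ ↦ {y : E3 | ‖y‖ ≤ (n : ℝ) ∧
      2 * (1 / ((n : ℝ) + 1)) ≤ Kerr.horizonFn M 0 (E4.ofTimeSpace (s + F y) y) ∧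
        (2 + η) * M ≤ Kerr.radius 0 (E4.ofTimeSpace (s + F y) y)} := by
    intro n m hnm y hy
    obtain ⟨h1, h2, h3⟩ := hy
    have hcast : (n : ℝ) ≤ m := Nat.cast_le.mpr hnm
    refine ⟨h1.trans hcast, le_trans ?_ h2, h3⟩
    have hn1 : (0 : ℝ) < (n : ℝ) + 1 := by positivity
    gcongr
  have hUnion : {y : E3 | (2 + η) * M ≤ Kerr.radius 0 (E4.ofTimeSpace (s + F y) y)} =
      ⋃ n : ℕ, {y : E3 | ‖y‖ ≤ (n : ℝ) ∧
        2 * (1 / ((n : ℝ) + 1)) ≤ Kerr.horizonFn M 0 (E4.ofTimeSpace (s + F y) y) ∧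
          (2 + η) * M ≤ Kerr.radius 0 (E4.ofTimeSpace (s + F y) y)} := by
    ext y
    simp only [mem_setOf_eq, mem_iUnion]
    constructor
    · intro hy
      have hr : 2 * M < Kerr.radius 0 (E4.ofTimeSpace (s + F y) y) := h2η.trans_le hy
      have hpos : 0 < Kerr.horizonFn M 0 (E4.ofTimeSpace (s + F y) y) := by
        unfold Kerr.horizonFn
        rw [Kerr.rPlus_zero_right hM.le]
        exact mul_pos (sub_pos.mpr hr) (Real.exp_pos _)
      obtain ⟨n, hn⟩ := exists_nat_ge (max ‖y‖ (2 / Kerr.horizonFn M 0 (E4.ofTimeSpace (s + F y) y)))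
      refine ⟨n, (le_max_left _ _).trans hn, ?_, hy⟩
      have h2 : 2 / Kerr.horizonFn M 0 (E4.ofTimeSpace (s + F y) y) ≤ n := (le_max_right _ _).trans hn
      have hn1 : (0 : ℝ) < (n : ℝ) + 1 := by positivity
      rw [div_le_iff₀ hpos] at h2
      rw [mul_one_div, div_le_iff₀ hn1]
      nlinarith
    · rintro ⟨n, -, -, hy⟩
      exact hy
  rw [hUnion]
  exact restFrame_lintegral_exhaustion hmono fun n ↦
    hcore (n : ℝ) (1 / ((n : ℝ) + 1)) n.cast_nonneg (by positivity)

end Summit.FinalStateConjecture.FinalStateConjecture.Theorems
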